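import Summits.BirchSwinnertonDyer.BirchSwinnertonDyer.Theorems.ByReductionTypeAtTwoRankOneAtTwoBigImageOddLocalOneDoorBottomFrame
import Summits.BirchSwinnertonDyer.BirchSwinnertonDyer.Theorems.ByReductionTypeAtTwoRankOneAtTwoBigImageOddLocalOneDoorBottomAssemblyNegFull
import Summits.BirchSwinnertonDyer.BirchSwinnertonDyer.Theorems.ByReductionTypeAtTwoRankOneAtTwoBigImageOddLocalOneDoorBottomPosAssembly
import Summits.BirchSwinnertonDyer.BirchSwinnertonDyer.Theorems.ByReductionTypeAtTwoRankOneAtTwoBigImageOddLocalOneDoorBottomFirstLayerNeg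
import Summits.BirchSwinnertonDyer.BirchSwinnertonDyer.Theorems.ByReductionTypeAtTwoRankOneAtTwoBigImageOddLocalOneDoorBottomFirstLayerPos
import Summits.BirchSwinnertonDyer.BirchSwinnertonDyer.Theorems.GenusKolyvaginAtTwoKolyvaginRelationAtTwo
import HarnessLib

/-!
# Route ByReductionTypeAtTwo, crux `RankOneAtTwoBigImageOddLocal` (stmt-BirchSwinnertonDyer-23715), LINE v8.12 `one_door_analytic`:
# THE BOTTOM RUNG U₀ FROM PRINT — `DoorIndexLawUpperCAtTwoBottom` modulo Gross–Zagier, Kolyvagin, modularity, Hoffstein–Luo, Cassels–Tate and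
# Gross 1991 Prop. 3.7 (2)

Lead prover seat `bsd-line-fkl-p1` g13 (2026-08-28), `--supports stmt-BirchSwinnertonDyer-23715` (helper).  THEOREMS ONLY; no definition, no named
fact introduced, no `sorry`; BSD is not proved by any of this.  CONDITIONAL results: every hypothesis is a PRINT named fact of the tree (or route
GenusKolyvaginAtTwo's item 24880, itself print-conditional).

The bottom rung U₀ of the Euler-system half of the crux (`DoorIndexLawUpperCAtTwoBottom`, `Theorems/…OneDoorLawBottomDefs.lean` p639188: for `W` on the
slice, a door-admissible Heegner field with `L(W^{(d_K)}, 1) ≠ 0`, a MINIMAL door `t + 2s = [Δ_W < 0]`, an odd constant and a Heegner point with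
`m = 0`, the `2`-parts of `Ш(W)` and `Ш(W^{(d_K)})` vanish — Kolyvagin's first `2`-descent over `ℚ`) is assembled here BY NAME from the tree's kernel
theorems of skeleton v8.12: the frame (`doorIndexLawUpperCAtTwoBottom_of_leaves`), the sign split (`firstDescentLeavesAtTwoBottom_of_neg_of_pos`), the two
assemblies (`firstDescentLeavesAtTwoBottomNeg_of_classes`, the width seat fkl-p2's `firstDescentLeavesAtTwoBottomPos_of_classes`), the two first-layer
theorems (`firstLayerClassesAtTwoBottomNeg/Pos_of_kolyvaginRelationAtTwo`) and route GenusKolyvaginAtTwo's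
`GenusExact.kolyvaginRelationAtTwo_of_frobeniusCongruence`.

* `firstDescentLeavesAtTwoBottom_of_kolyvaginRelationAtTwo` — U₀'s input EXISTS at every bottom-rung datum, modulo the four primary printed facts
  and item 24880.
* `doorIndexLawUpperCAtTwoBottom_of_kolyvaginRelationAtTwo` — U₀ modulo the four primary facts, Cassels–Tate, and item 24880.
* `doorIndexLawUpperCAtTwoBottom_of_print` — **U₀ modulo PRINT only**: Gross–Zagier (`gross_zagier`), Kolyvagin (`kolyvagin`), modularity
  (`exists_isNewformOf`), Hoffstein–Luo 1997 (`HoffsteinLuo1997_exists_twist_L_one_ne_zero`), Cassels 1962 (`exists_casselsTate_pairing`), Gross 1991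
  Prop. 3.7 (2) = Nekovář 2007 Prop. 4.9 (`GrossLMS1991.prop37_2_frobeniusCongruence`).

References: [GrossLMS1991] §§3–6, §10; [McCallumLMS1991] §§3–5; [Kolyvagin1989Izv] §3; [Kolyvagin1990] Thm. A; [MazurRubin2010] §2;
[Kramer1981] Props. 3, 6; [Cassels1962] ; [Nekovar2007] Prop. 4.9; [HoffsteinLuo1997].
-/

set_option autoImplicit false
-- the Theorems namespace of this sub repeats the summit name by design (D-0017 nested layout)
set_option linter.dupNamespace false

noncomputable section

open scoped Classical

namespace Summit.BirchSwinnertonDyer.BirchSwinnertonDyer.Theorems.RankOneAtTwoOneDoor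

open WeierstrassCurve NumberField Literature.NumberTheory.EllipticCurves Literature.NumberTheory.EllipticCurves.ModularForms

/-- **U₀'s input exists at every bottom-rung datum, modulo print + item 24880**: `FirstDescentLeavesAtTwoBottom` from Gross–Zagier, Kolyvagin,
modularity, Hoffstein–Luo and route GenusKolyvaginAtTwo's `KolyvaginRelationAtTwo` — the sign split, the two assemblies and the two first-layer
theorems of skeleton v8.12. [cite: GrossLMS1991, §10] [cite: Kolyvagin1989Izv, §3] -/
theorem firstDescentLeavesAtTwoBottom_of_kolyvaginRelationAtTwo
    (hGZ : ∀ (N : ℕ) [NeZero N] (W : WeierstrassCurve ℚ) (K : Type) [Field K] [NumberField K], gross_zagier N W K)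
    (hKo : ∀ (N : ℕ) [NeZero N] (W : WeierstrassCurve ℚ) (K : Type) [Field K] [NumberField K], kolyvagin N W K)
    (hnf : exists_isNewformOf) (hHL : HoffsteinLuo1997_exists_twist_L_one_ne_zero)
    (hrel : Summit.BirchSwinnertonDyer.BirchSwinnertonDyer.Theses.GenusKolyvaginAtTwo.KolyvaginRelationAtTwo) :
    FirstDescentLeavesAtTwoBottom := by
  have hclP : FirstLayerClassesAtTwoBottomPos := firstLayerClassesAtTwoBottomPos_of_kolyvaginRelationAtTwo hrel
  exact firstDescentLeavesAtTwoBottom_of_neg_of_pos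
    (firstDescentLeavesAtTwoBottomNeg_of_classes hGZ hKo hnf hHL (firstLayerClassesAtTwoBottomNeg_of_kolyvaginRelationAtTwo hrel))
    (firstDescentLeavesAtTwoBottomPos_of_classes hGZ hKo hnf hHL
      (fun W _ _ _ hCM hsurj hT hc hr K _ _ hK hadm hLt Dt H ι P hP Wd _ _ Cd hWd hmin hodd hm hΔ w₀ hdivK y hymem hyres =>
        hclP W hCM hsurj hT hc hr K hK hadm hLt Dt H ι P hP Wd Cd hWd hmin hodd hm hΔ w₀ hdivK y hymem hyres))

/-- **U₀ modulo print + item 24880**: `DoorIndexLawUpperCAtTwoBottom` from Gross–Zagier, Kolyvagin, modularity, Hoffstein–Luo, Cassels–Tate and route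
GenusKolyvaginAtTwo's `KolyvaginRelationAtTwo` (through the frame `doorIndexLawUpperCAtTwoBottom_of_leaves`). [cite: GrossLMS1991, §10] [cite: Kolyvagin1990, Thm. A] -/
theorem doorIndexLawUpperCAtTwoBottom_of_kolyvaginRelationAtTwo
    (hGZ : ∀ (N : ℕ) [NeZero N] (W : WeierstrassCurve ℚ) (K : Type) [Field K] [NumberField K], gross_zagier N W K)
    (hKo : ∀ (N : ℕ) [NeZero N] (W : WeierstrassCurve ℚ) (K : Type) [Field K] [NumberField K], kolyvagin N W K)
    (hnf : exists_isNewformOf) (hHL : HoffsteinLuo1997_exists_twist_L_one_ne_zero)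
    (hCT : exists_casselsTate_pairing (K := ℚ))
    (hrel : Summit.BirchSwinnertonDyer.BirchSwinnertonDyer.Theses.GenusKolyvaginAtTwo.KolyvaginRelationAtTwo) :
    DoorIndexLawUpperCAtTwoBottom :=
  doorIndexLawUpperCAtTwoBottom_of_leaves hGZ hKo hnf hHL hCT (firstDescentLeavesAtTwoBottom_of_kolyvaginRelationAtTwo hGZ hKo hnf hHL hrel)

/-- **THE BOTTOM RUNG U₀ OF 23715 MODULO PRINT ONLY**: `DoorIndexLawUpperCAtTwoBottom` — at every minimal door of the slice with an odd constant and
a Heegner point with `m = 0`, `Ш(W)[2^∞]` and `Ш(W^{(d_K)})[2^∞]` are trivial — from Gross–Zagier 1986, Kolyvagin 1990, modularity (BCDT 2001),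
Hoffstein–Luo 1997, Cassels 1962, and Gross 1991 Prop. 3.7 (2) = Nekovář 2007 Prop. 4.9 (through `GenusExact.kolyvaginRelationAtTwo_of_frobeniusCongruence`).
CONDITIONAL on these six named facts; nothing about them is proved here. [cite: GrossLMS1991, §10 and Prop. 3.7 (2)] [cite: Kolyvagin1990, Thm. A]
[cite: Nekovar2007, Prop. 4.9] -/
theorem doorIndexLawUpperCAtTwoBottom_of_print
    (hGZ : ∀ (N : ℕ) [NeZero N] (W : WeierstrassCurve ℚ) (K : Type) [Field K] [NumberField K], gross_zagier N W K)
    (hKo : ∀ (N : ℕ) [NeZero N] (W : WeierstrassCurve ℚ) (K : Type) [Field K] [NumberField K], kolyvagin N W K)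
    (hnf : exists_isNewformOf) (hHL : HoffsteinLuo1997_exists_twist_L_one_ne_zero)
    (hCT : exists_casselsTate_pairing (K := ℚ))
    (h37 : Literature.NumberTheory.EllipticCurves.GrossLMS1991.prop37_2_frobeniusCongruence) :
    DoorIndexLawUpperCAtTwoBottom :=
  doorIndexLawUpperCAtTwoBottom_of_kolyvaginRelationAtTwo hGZ hKo hnf hHL hCT
    (Summit.BirchSwinnertonDyer.BirchSwinnertonDyer.Theorems.GenusExact.kolyvaginRelationAtTwo_of_frobeniusCongruence h37)

end Summit.BirchSwinnertonDyer.BirchSwinnertonDyer.Theorems.RankOneAtTwoOneDoor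

end
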